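import Mathlib
import HarnessLib
import HarnessLib.Audit
import Summits.Schanuel.Statement
import HarnessLib.Audit.Status.Attr

/-!
Route: CoprimeExpPolynomials

DORMANT since 2026-08-23T20:04:18Z (reconciler: no traction for 6.2 d (last activity item-evidence-added at 2026-08-17T14:28:55Z); parked, not closed — `ledger route dormant route-Schanuel-CoprimeExpPolynomials --off` to reactivate) — unstaffed, not closed; items shared with open routes are served there. `ledger route dormant <id> --off` reactivates.

# Route CoprimeExpPolynomials — Schanuel graded by ℚ̄-rank — rank 1 ⟺ coprime exponential
polynomials over ℚ̄ do not meet off the origin; Shapiro finiteness as the unconditional rung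

It suffices to show X = QbarRankGradedSchanuel: for every r and every ζ ∈ ℂ^r with ℚ̄-linearly
independent
coordinates, every algebraic n×r matrix b with ℚ-linearly independent rows satisfies trdeg_ℚ ℚ(ζ,
e^{b₁·ζ}, …, e^{bₙ·ζ}) ≥ n
(Schanuel for the tuple z = bζ, which has exact ℚ̄-rank r). X is Schanuel filtered by r := dim_ℚ̄
span_ℚ̄(z₁..zₙ), and
X ⟺ Schanuel (Assembly: choose a ℚ̄-basis of the span; GradedOfSchanuel: apply Schanuel to bζ). The
route stakes the
r = 1 layer (card coprime-exponential-polynomials): RankOneSchanuel = "Lindemann–Weierstrass at a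
transcendental scale"
⟺ CoprimeExpPolynomialsNoCommonZero = "two coprime elements of the Ritt ring 𝒫 = ℚ̄[x][e^{βx} : β ∈
ℚ̄] have no common
zero in ℂ∖{0}" (Jossen's Conjecture 1.1(ii) on 𝒫; Schanuel ⟹ it is FischlerRivoal2025 Thm 1.7/4.1),
with Shapiro's 1958
conjecture over ℚ̄ (finiteness of common zeros) as the unconditional rung below it and
DilationRigidity as its n = 2 layer.
Lean: `∀ (r n : ℕ) (ζ : Fin r → ℂ) (b : Fin n → Fin r → ℂ), (∀ c : Fin r → ℂ, (∀ j, IsAlgebraic ℚ (c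
j)) → ∑ j, c j * ζ j = 0 → c = 0) → (∀ i j, IsAlgebraic ℚ (b i j)) → LinearIndependent ℚ b → (n :
Cardinal) ≤ Algebra.trdeg ℚ ↥(IntermediateField.adjoin ℚ (Set.range ζ ∪ Set.range (fun i =>
Complex.exp (∑ j, b i j * ζ j))))`

## Assembly
Bookkeeping over Mathlib, staffable now: given z : Fin n → ℂ ℚ-linearly independent, let r = dim_ℚ̄
span_ℚ̄(range z), pick a ℚ̄-basis
ζ of that span (finite-dimensional subspace of ℂ over the field ↥(algebraicClosure ℚ ℂ)) and the
algebraic coordinate matrix b with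
z i = Σ_j b i j * ζ j; the rows of b are ℚ-linearly independent because z is; X gives n ≤ trdeg ℚ(ζ,
eᶻ); finally ζ_j ∈ span_ℚ̄(z) makes
ℚ(ζ, eᶻ) algebraic over a subfield of ℚ(c, z, eᶻ) with c algebraic, so trdeg ℚ(z, eᶻ) ≥ trdeg ℚ(ζ,
eᶻ) ≥ n (trdeg is monotone and
unchanged by adjoining algebraic elements; both lemmas exist in tree,
Literature.Barriers.Schanuel.trdeg_adjoin_union_eq_of_isAlgebraic,
LargeTranscendenceDegree.trdeg_mono). The cruxes feed X through the supports: crux 2 ⟺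
RankOneSchanuel ⟺ (X at r = 1); crux 3 ⟸ crux 2;
crux 4 ⟸ RankOneSchanuel; crux 5 ⟸ crux 4.

Rationale: WHY THIS LINE. The ℚ̄-rank is transversal to every grading in play (by n, by Khovanskii depth in the
closed EclCore, by the (d,ℓ)-grid of
AlgIndepMethod, by function class) and its extreme r = 1 is ONE complex variable, where exponential
polynomials have a structure
theory with no several-variables analogue: unique factorisation into simple and irreducible elements
(Ritt1927, MacColl1935,
EverestVanDerPoorten1997), zero distribution in finitely many strips (Ritt1929), a Nevanlinna
Nullstellensatz (HensonRubel1984),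
Skolem–Mahler–Lech p-adic analyticity for simple factors (VanDerPoortenTijdeman1975) and a p-adic
proof of Lindemann–Weierstrass as
"divisibility by x − a descends from entire functions to 𝒫" (BezivinRobba1989). On 𝒫 Schanuel
becomes one sentence without numbers —
coprime elements do not meet off the origin (FischlerRivoal2025 Thm 1.7 derive it from SC; the
converse to rank-1 SC is the support
item RankOneOfCoprime) — and the sentence has a WEAKENING that is a 68-year-old analytic conjecture
with unconditional cases and three
working engines: Shapiro1958 finiteness (Case 1 proved by p-adic SML in VanDerPoortenTijdeman1975 /
DaquinoMacintyreTerzo2014 §3; Case 2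
only under SC, ibid. §5 via Bombieri–Masser–Zannier; Baker-based finiteness of rational solution
families, MantovaZannier2016 Thm 1.3;
unit-orbit analyticity for real-quadratic slopes, card pell-orbit-analyticity-shapiro). Imported
areas: factorisation theory of
exponential polynomials and value distribution (complex analysis), p-adic methods for recurrences,
unlikely intersections; no
probabilistic or physical model (none has a dictionary reaching a fixed transcendental point). What
prior routes do not do: no open
route has an item about ZERO SETS; AlgIndepMethod's rung LogAlphaAlphaBetaAlgIndep
(stmt-Schanuel-0084) reappears here as the first
named cell of DilationRigidity and is shared, not duplicated.

RANKED CRUXES. #0 QbarRankGradedSchanuel (target) — Schanuel graded by exact ℚ̄-rank: for ζ : Fin r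
→ ℂ with no nontrivial algebraic-coefficient linear relation and b an algebraic n×r matrix with
ℚ-linearly independent rows, n ≤ trdeg_ℚ ℚ(ζ, (e^{Σ_j b_ij ζ_j})_i). All r ⟺ Schanuel; r = 1 ⟺
RankOneSchanuel ⟺ CoprimeExpPolynomialsNoCommonZero. (why it might fail: X ⟺ Schanuel, so it fails
iff Schanuel does; its layers r ≥ 2 contain Literature.Barriers.Schanuel.AlgIndepLogarithms and (1,
πi) — the route's traction is confined to r = 1 and no mechanism here climbs to r = 2.) [Lang1966,
Waldschmidt2000, FischlerRivoal2025]
#2 CoprimeExpPolynomialsNoCommonZero (crux) — (card OOP(1); Jossen Conj. 1.1(ii) on 𝒫) two COPRIME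
exponential polynomials over ℚ̄ — encoded as P, Q ∈ ℚ̄[X₀..Xₙ] relatively prime, evaluated at (z,
e^{β₁z}, …, e^{βₙz}) with β₁..βₙ ∈ ℚ̄ ℚ-linearly independent — have no common zero z ≠ 0. Equivalent
to rank-1 Schanuel (supports CoprimeOfRankOne / RankOneOfCoprime); Schanuel ⟹ it (FischlerRivoal2025
Thm 1.7/4.1); 0 is a genuine exception (eᶻ − 1, e^{√2 z} − 1). [difficulty: open-problem] (why it
might fail: It contains Gel'fond's (log 2, 2^√2) and (π, e^{iπ√2}); unconditionally only an
ALGEBRAIC common root is excluded (Beukers/LW, FischlerRivoal2025 p.3); one coprime pair over ℚ̄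
meeting at some z ≠ 0 refutes Schanuel outright, and no systematic certified search has been run.)
[FischlerRivoal2025, Ritt1927, MacColl1935, Lang1966, DaquinoMacintyreTerzo2014]
#3 CoprimeExpPolynomialsFiniteCommonZeros (crux) — (card S3, re-graded crux by triage) Shapiro's
conjecture over ℚ̄, finiteness rung of the purity ladder: two coprime exponential polynomials over
ℚ̄ (same encoding, polynomial coefficients allowed) have only FINITELY many common zeros. Trivially
below crux 2 (FiniteOfNoCommonZero); under Schanuel a theorem (FischlerRivoal2025 Thm 1.7;
DaquinoMacintyreTerzo2014 for constant coefficients over ℂ); unconditional when one factor is simple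
(VanDerPoortenTijdeman1975, p-adic Skolem–Mahler–Lech) — the target where the route's engines
already bite. [difficulty: open-problem] (why it might fail: Open since 1958 even for constant
coefficients: two IRREDUCIBLE factors (Ritt Case 2) are handled only under SC
(DaquinoMacintyreTerzo2014 §5, BMZ + Evertse–Schlickewei–Schmidt); one real slope of degree ≥ 3 or
non-torsion phases has no p-adic/unit-orbit structure; Baker's k^{-C} is too weak.) [Shapiro1958,
VanDerPoortenTijdeman1975, DaquinoMacintyreTerzo2014, MantovaZannier2016, EverestVanDerPoorten1997,
Ritt1929]
#4 DilationRigidity (crux) — (card n = 2 form) the countable set 𝒮 = {y : (y, eʸ) algebraically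
dependent over ℚ} of simply-exponential-algebraic numbers (ℚ̄, log ℚ̄, πi·ℚ, fixed points of exp, Ω,
zeros of every p(z, eᶻ)) meets none of its irrational algebraic dilates off ℚ̄: y ∈ 𝒮
transcendental, β ∈ ℚ̄∖ℚ ⟹ (βy, e^{βy}) algebraically independent. Equals the n = 2 layer of
RankOneSchanuel given Lindemann–Weierstrass (DilationOfRankOne); cells: y = log α (crux 5), y = πi
(β = i√d PROVED: Nesterenko; β = √2 open), y a fixed point of exp (no classical name). [difficulty:
open-problem] (why it might fail: Its cells are Gel'fond's conjecture (Waldschmidt2004 §3.1), (π,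
e^{iπ√2}) and the fixed points of exp, all at the d=2, ℓ=1 grid point below every
algebraic-independence criterion (NesterenkoPhilippon2001 Ch.14 Thm 2.9 needs dℓ > d+ℓ); only the CM
dilates y = πi, β = i√d are proved (Nesterenko 1996).) [Waldschmidt2004, Gelfond1934,
NesterenkoPhilippon2001, Chudnovsky1984, FischlerRivoal2025, Marker2006]
#5 LogAlphaAlphaBetaAlgIndep (crux) — (shared verbatim with route AlgIndepMethod,
stmt-Schanuel-0084; card C1) Gel'fond's conjecture: for algebraic α = eˡ with l ≠ 0 and algebraic
irrational β, l and e^{βl} = α^β are algebraically independent — the first named cell F₁ = eˣ − α of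
crux 2 / y = log α of crux 4 (LogCellOfDilation). Re-asked here so both routes want it. [deps:
DilationRigidity] [difficulty: open-problem] (why it might fail: Open even for (log 2, 2^√2) since
Gelfond1934; the 2×2 grid (1, β)×(l) gives trdeg ≥ 1 only and every Gel'fond-type criterion needs dℓ
> d+ℓ (NesterenkoPhilippon2001 Ch.14 Thm 2.9); the one proved case (α root of unity, β imaginary
quadratic) is modular.) [Gelfond1934, Chudnovsky1984, Waldschmidt2004, NesterenkoPhilippon2001]
#9 RankOneSchanuel (support) — rank-one Schanuel in transcendence-degree form
("Lindemann–Weierstrass at a transcendental scale"): ζ ≠ 0, β₁..βₙ algebraic and ℚ-linearly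
independent ⟹ trdeg_ℚ ℚ(ζ, e^{β₁ζ}, …, e^{βₙζ}) ≥ n. The r = 1 layer of the target (RankOneOfGraded)
and the hinge to crux 2 (CoprimeOfRankOne, RankOneOfCoprime); a special case of Schanuel, OPEN (not
provable now) — filed as the named statement other routes/cards can share; ζ algebraic is
Lindemann–Weierstrass (proved in tree). [difficulty: open-problem] [FischlerRivoal2025, Lang1966,
Baker1975]
#9 CoprimeOfRankOne (support) — trdeg form ⟹ zero-set form: if coprime P, Q ∈ ℚ̄[X₀..Xₙ] both vanish
at q = (z, e^{βz}) with z ≠ 0 then trdeg_ℚ ℚ(q) ≤ n − 1 (if it were n, the ideal of q would be a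
height-one prime, principal in the UFD ℚ̄[X]; Gauss-lemma form: the primitive minimal polynomial of
the one dependent coordinate divides every relation, hence divides P and Q), contradicting
RankOneSchanuel. Pure commutative algebra over Mathlib (MvPolynomial.finSuccEquiv/renameEquiv,
Polynomial.IsPrimitive Gauss lemma). [difficulty: provable-now] [FischlerRivoal2025, Lang1966]
#9 RankOneOfCoprime (support) — zero-set form ⟹ trdeg form (the direction not printed in
FischlerRivoal2025): if trdeg_ℚ ℚ(ζ, e^{βζ}) ≤ n − 1, take a maximal algebraically independent set S
of coordinates (|S| ≤ n − 1) and two further coordinates a, c; the primitive (hence irreducible,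
Gauss) minimal relation P of a over ℚ̄[S] and any nonzero relation Q of c in ℚ̄[S][C] are relatively
prime (P involves the variable A, Q does not) and both vanish at the point — contradiction with crux
2 at z = ζ ≠ 0. [difficulty: provable-now] [FischlerRivoal2025, Lang1966]
#9 RankOneOfGraded (support) — the r = 1 specialisation of the target: ζ : Fin 1 → ℂ has no
algebraic relation iff ζ 0 ≠ 0; b : Fin n → Fin 1 → ℂ ℚ-independent iff (b · 0) is; Fin.sum_univ_one
and range ![ζ₀] = {ζ₀} identify the two adjoins. [difficulty: provable-now] [Lang1966]
#9 GradedOfSchanuel (support) — calibration Schanuel ⟹ X: z := bζ is ℚ-linearly independent (ζ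
ℚ̄-free, rows of b ℚ-free), Schanuel gives trdeg ℚ(z, eᶻ) ≥ n, and ℚ(z, eᶻ) ⊆ ℚ(b)(ζ, eᶻ) is
algebraic over ℚ(ζ, eᶻ) (tree lemma
Literature.Barriers.Schanuel.trdeg_adjoin_union_eq_of_isAlgebraic pattern). With Assembly this
records X ⟺ Schanuel. [difficulty: provable-now] [Lang1966, Waldschmidt2000]
#9 DilationOfRankOne (support) — the n = 2 layer: apply RankOneSchanuel to ζ = y, β = (1, β): trdeg
ℚ(y, eʸ, e^{βy}) ≥ 2; since eʸ is algebraic over ℚ(y) (y ∈ 𝒮), y and e^{βy} are algebraically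
independent, hence so are βy and e^{βy} (β algebraic ≠ 0). [difficulty: provable-now]
[FischlerRivoal2025, Waldschmidt2004]
#9 LogCellOfDilation (support) — crux 5 is the cell y = l of crux 4: eˡ = α ∈ ℚ̄ puts l in 𝒮, l is
transcendental by Hermite–Lindemann (tree:
Literature.NumberTheory.Transcendental.LindemannWeierstrass, proved), and algebraic independence of
(βl, e^{βl}) transfers to (l, e^{βl}). [difficulty: provable-now] [Lindemann1882, Waldschmidt2004]
#9 FiniteOfNoCommonZero (support) — the finiteness rung sits below crux 2: the common-zero set is a
subset of {0} (encoding check; 6-line proof in the planner's Sketch.lean). [difficulty: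
provable-now] [FischlerRivoal2025, Shapiro1958]

TWO-LAYER PLAN. Foreseen glued splits (nothing filed now): crux 3 ⇐ ShapiroQbarSimpleFactor →
ShapiroQbarTwoIrreducibles → crux 3, glue = Ritt–MacColl
factorisation reduces a coprime pair to the two cases (DaquinoMacintyreTerzo2014 §2; child 1 is
VanDerPoortenTijdeman1975 transposed to
polynomial coefficients, child 2 is where pell-orbit-analyticity-shapiro's Theorem P (real-quadratic
slope, torsion phases) and the
subspace-theorem case (two independent slopes) enter as `--supports` lemmas, leaving its atoms (one
real slope of degree ≥ 3; non-torsion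
phases)). Crux 2 ⇐ NoCommonZeroSimpleFactor → NoCommonZeroIrreducibleFactor → crux 2 by the same
factorisation + FischlerRivoal2025 Cor 4.3
dichotomy (child 1 = "LW over 𝓛-points", the Gel'fond–Schneider/ladder sector; child 2 = irreducible
h(ξ) = 0, containing the fixed
points of exp and Ω). Crux 4 is not split (its cells do not exhaust 𝒮); cells (fixed point of exp
with one algebraic frequency; y = πi,
β real quadratic) are filed later as supports of crux 4, cross-linked with card
tight-tuples-relative-hl-fixed-points.

KILL CRITERIA. A coprime pair over ℚ̄ with a CERTIFIED common zero z ≠ 0 (¬crux 2), or with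
infinitely many common zeros (¬crux 3), or a dilation
counterexample (¬crux 4) refutes RankOneSchanuel and therefore Schanuel: close `refuted:<Decl>` and
hand the witness to every Schanuel
route (they all die). A refutation that exploits the ENCODING only (IsRelPrime in ℚ̄[X₀..Xₙ] vs gcd
in 𝒫, negative exponents, a unit P)
forces a restate, not a close — the planner checked units/P = 0/n = 0 and the stability of
coprimality under u ↦ u^{1/N} (flat going-down)
and under Laurent localisation, but a refuter should re-derive it. If crux 3 is PROVED ineffectively
the line pivots to an effective box
(common zeros of a coprime pair lie in |z| ≤ B(P, Q, β)) as the new rank-3 crux; if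
LogAlphaAlphaBetaAlgIndep closes in AlgIndepMethod
it closes here too (shared item) and crux 4 is re-ranked. Nothing proved elsewhere moots crux 2
short of Schanuel itself.

NOT DECOMPOSED YET. The purity-ladder ENGINE statements are deliberately not items: (a) descent of
divisibility by a SIMPLE g ∈ ℚ̄[e^{x/N}] from entire
functions to 𝒫 up to powers of x (expected provable, soft), (b) Bézivin–Robba p-adic rationality of
the Borel transform of F₂/F₁ when the
pole set log α + 2πiℤ is transcendental (the one speculative mechanism; BezivinRobba1989), (c)
Pólya–Ritt strip asymptotics + Baker phase
matching giving an explicit box for common zeros — each becomes a layer-2 child of crux 3 or crux 2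
only after a prover proposes a typed
statement. Also not decomposed: OOP(r) for r ≥ 2 in zero-set form (height-(r+1) ideals need
dimension theory absent from Mathlib), the
fixed-point cell, the certified search N1 (kit: coprime pairs of height ≤ H in ℤ[x, eˣ, e^{√2x}],
interval Newton in a box), and any
bundled definition of 𝒫 (the MvPolynomial-over-algebraicClosure encoding avoids a definition
request).

CHEAPEST FALSIFIER. (i) Encoding audit, minutes in Lean: instantiate crux 2 with P = X₁ − 1, Q = X₂
− 1, β = (1, √2) (must reduce to "2πik = 2πil/√2 ⟹ k = l = 0",
true) and with P = X₁ − 2, Q = X₂ − 3 (must reduce to Gel'fond–Schneider, true); any instance where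
IsRelPrime holds but the two functions
share a factor in 𝒫 kills the encoding (planner's argument: impossible by flat going-down under Xᵢ ↦
Xᵢ^N — refuter re-check). (ii) Lookup:
Zilber2002 (JLMS 65) and D'Aquino–Macintyre–Terzo, Fund. Math. 207 (2010) for a printed "SC|rank 1 ⟺
coprime pairs" or the ℚ̄-rank grading —
demotes novelty to known, does not kill (FischlerRivoal2025 print only SC ⟹ crux 2). (iii) kit job
(not run in this one-shot seat): enumerate
coprime P, Q ∈ ℤ[X₀, X₁, X₂] of total degree ≤ 2, height ≤ 3, β = (1, √2); Newton + interval
certification of common zeros of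
P(z, eᶻ, e^{√2z}), Q(…) in |z| ≤ 40; one certified z ≠ 0 refutes Schanuel.

NUMBERS. Shapiro's conjecture: 1958 (Shapiro1958), Case 1 proved 1975 (VanDerPoortenTijdeman1975),
Case 2 conditional 2014 (DaquinoMacintyreTerzo2014);
Jossen's conjecture 2021, SC ⟹ crux 2 printed 2025 (FischlerRivoal2025 Thm 1.7); unconditional
instances of crux 2: algebraic common root only
(Beukers 2006 / LW 1885). Crux 4/5 sit at the grid point d = 2, ℓ = 1 where dℓ = 2 < d + ℓ = 3
(NesterenkoPhilippon2001 Ch.14 Thm 2.9 needs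
dℓ > d + ℓ); proved dilates: y = πi, β = i√d, d ∈ ℕ squarefree (Nesterenko 1996: trdeg(π, e^{π√d}) =
2). Items at open: 14 (1 target,
1 assembly, 4 cruxes, 8 supports); named facts used as hypotheses: 0; imports beyond the Statement:
0.

DEFINITION REQUESTS. None. 𝒫 is encoded as MvPolynomial (Fin (n+1)) ↥(algebraicClosure ℚ ℂ)
evaluated at (z, e^{βᵢz}); ℚ̄-linear independence of ζ is written
as the absence of an algebraic-coefficient relation. A later cite-fact candidate (not filed): the
Ritt–MacColl unique factorisation of 𝒫
(Ritt1927, MacColl1935, EverestVanDerPoorten1997) as `Literature.…` named fact, needed only by the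
foreseen split glue.

Novelty: Searches (2026-08-15): `lit frontier Schanuel --since 2020` (30 rows; none on zero sets of
exponential polynomials), `lit bridges Schanuel
--cross any` (30 rows; unit equations/BMZ circle only via Evertse–Győry), `lit galaxy search "common
zeros of exponential polynomials" --star all`
(3 rows: Laczkovich, Enseign. Math. 50 (2004) on a different Shapiro conjecture; CJM 67 (2015)
SML-type; Borwein–Shparlinski volume),
`lit galaxy search "Shapiro's conjecture" --star all` (14 rows; relevant: D'Aquino–Fornasiero–Terzo
Trans. AMS 370 (2018) generic solutions),
`lit search --hybrid "common zeros exponential polynomials algebraic coefficients Schanuel coprime"`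
(12 local docs: Baker1975 p.112,
Chudnovsky1984, NesterenkoPhilippon2001 p.267 — no zero-set formulation), `lit vsearch` on the
Shapiro sentence (0 relevant), `lit read`
arXiv:2503.20345 pp.3–5, 9–10; arXiv:1206.6747 pp.3–5, 9; arXiv:1402.0685 pp.2–3; arXiv:math/0312440
§3.1; remote OpenAlex/arXiv HTTP 429
all session; `ledger negatives --problem Schanuel` (0); the four open route files and the triage
notes of refuter-triage-3/16 on the card.
Nearest prior art found: FischlerRivoal2025 (arXiv:2503.20345) Conj. 1.1(ii) (Jossen 2021) and Thm
1.7/4.1/Cor 4.3 — crux 2 as a conjecture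
on 𝒫 and its derivation from SC, with the remark (p.3) that only the algebraic-root case is known;
DaquinoMacintyreTerzo2014 (arXiv:1206.6747)
— Shapiro ⟸ SC, Case 1 unconditional after VanDerPoortenTijdeman1975; MantovaZannier2016 Thm 1.3 —
Baker-ba  [refs: 2503.20345, 1206.6747, 1402.0685, math/0312440, Baker1975, Chudnovsky1984, NesterenkoPhilippon2001, FischlerRivoal2025, DaquinoMacintyreTerzo2014, VanDerPoortenTijdeman1975, MantovaZannier2016]

Barriers (technique_class: ritt-factorisation exp-polynomial-zeros shapiro p-adic-sml): - technique_class: ritt-factorisation exp-polynomial-zeros shapiro p-adic-sml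
- Literature.Barriers.Schanuel.LargeTranscendenceDegree: it does not evade it for cruxes 4/5 (d = 2,
ℓ = 1 is below smallTrdeg_thm_2_9's dℓ > d + ℓ and below WaldschmidtConjecture_2_3); the bet is that
rank-1 tuples carry ONE-VARIABLE structure (Ritt1927/MacColl1935 factorisation, Ritt1929 strip
asymptotics, BezivinRobba1989 p-adic rationality) that several-variables tuples lack, and crux 3 is
where that structure has already yielded theorems (VanDerPoortenTijdeman1975, MantovaZannier2016 Thm
1.3).
- Literature.Barriers.Schanuel.AlgebraicIndependenceOfLogarithms: does not meet the staffed sector —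
two ℚ-independent logarithms of algebraic numbers are never ℚ̄-proportional (Baker), so
AlgIndepLogarithms lives in layers r ≥ 2 of the target, which this route leaves to
ToricPeriods/RoyCriterion-type lines; accepted for the target as a whole.
- Literature.Barriers.Schanuel.EFunctionValuesAtAlgebraicPoints: applies squarely to crux 2 —
elements of 𝒫 are E-functions and Siegel–Shidlovskii/Beukers deliver exactly its algebraic-root case
(FischlerRivoal2025 p.3) and nothing at a transcendental zero; the line does not evaluate at points
at all: its engines act on ZERO SETS (SML p-adic interpolation of the index, factorisation,
counting), which is how VanDerPoortenTijdeman1975 proved a Shapiro case no E-function method states.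
- Literature.Barriers.Schanuel.NesterenkoModularScope: supplies the only proved tran

History (route lifecycle, newest last):
- 2026-08-16T04:16:58Z · AUTO-CRUX (backfill): QbarRankGradedSchanuel — hypotheses of the deciding theorem that nothing in the route derives are cruxes (operator:999:1085951)
- 2026-08-23T20:04:18Z · DORMANT — reconciler: no traction for 6.2 d (last activity item-evidence-added at 2026-08-17T14:28:55Z); parked, not closed — `ledger route dormant route-Schanuel-Coprime (operator:999:3860066)

sub-problem: Schanuel · status: dormant · opened planner-plancard-Schanuel-Schanuel-coprime-ex-b7137f78-0 2026-08-15T11:23:56Z · rev 1 · ledger route-Schanuel-CoprimeExpPolynomials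
GENERATED by the gate from the ledger (D-0016/17). Provers cite these decls: `theorem foo : Summit.Schanuel.Schanuel.Theses.CoprimeExpPolynomials.<Decl> := …` in Summits/Schanuel/Schanuel/Theorems/<Name>.lean.
-/

namespace Summit.Schanuel.Schanuel.Theses.CoprimeExpPolynomials

open scoped BigOperators Topology Manifold Classical MeasureTheory ProbabilityTheory Matrix InnerProductSpace ComplexConjugate ContinuousMap
open Filter Set Function TopologicalSpace MeasureTheory

attribute [summit_statement] _root_.Schanuel

open Literature.Periods

/-- item stmt-Schanuel-3762 · crux (kind.auto-crux: conjecture-grade) · rank 0 · open · by planner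
why it might fail: X ⟺ Schanuel, so it fails iff Schanuel does; its layers r ≥ 2 contain Literature.Barriers.Schanuel.AlgIndepLogarithms and (1, πi) — the route's traction is confined to r = 1 and no mechanism here climbs to r = 2.
sources: Lang1966, Waldschmidt2000, FischlerRivoal2025
[target] Schanuel graded by exact ℚ̄-rank: for ζ : Fin r → ℂ with no nontrivial
algebraic-coefficient linear relation and b an algebraic n×r matrix with ℚ-linearly independent
rows, n ≤ trdeg_ℚ ℚ(ζ, (e^{Σ_j b_ij ζ_j})_i). All r ⟺ Schanuel; r = 1 ⟺ RankOneSchanuel ⟺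
CoprimeExpPolynomialsNoCommonZero. -/
@[route_item "route-Schanuel-CoprimeExpPolynomials", crux]
def QbarRankGradedSchanuel : Prop :=
  ∀ (r n : ℕ) (ζ : Fin r → ℂ) (b : Fin n → Fin r → ℂ), (∀ c : Fin r → ℂ, (∀ j, IsAlgebraic ℚ (c j)) → ∑ j, c j * ζ j = 0 → c = 0) → (∀ i j, IsAlgebraic ℚ (b i j)) → LinearIndependent ℚ b → (n : Cardinal) ≤ Algebra.trdeg ℚ ↥(IntermediateField.adjoin ℚ (Set.range ζ ∪ Set.range (fun i => Complex.exp (∑ j, b i j * ζ j))))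

/-- item stmt-Schanuel-3763 · crux · rank 2 · open · by planner
why it might fail: It contains Gel'fond's (log 2, 2^√2) and (π, e^{iπ√2}); unconditionally only an ALGEBRAIC common root is excluded (Beukers/LW, FischlerRivoal2025 p.3); one coprime pair over ℚ̄ meeting at some z ≠ 0 refutes Schanuel outright, and no systematic certified search has been run.
sources: FischlerRivoal2025, Ritt1927, MacColl1935, Lang1966, DaquinoMacintyreTerzo2014
[crux] (card OOP(1); Jossen Conj. 1.1(ii) on 𝒫) two COPRIME exponential polynomials over ℚ̄ —
encoded as P, Q ∈ ℚ̄[X₀..Xₙ] relatively prime, evaluated at (z, e^{β₁z}, …, e^{βₙz}) with β₁..βₙ ∈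
ℚ̄ ℚ-linearly independent — have no common zero z ≠ 0. Equivalent to rank-1 Schanuel (supports
CoprimeOfRankOne / RankOneOfCoprime); Schanuel ⟹ it (FischlerRivoal2025 Thm 1.7/4.1); 0 is a genuine
exception (eᶻ − 1, e^{√2 z} − 1). [difficulty: open-problem] -/
@[route_item "route-Schanuel-CoprimeExpPolynomials", crux]
def CoprimeExpPolynomialsNoCommonZero : Prop :=
  ∀ (n : ℕ) (β : Fin n → ↥(algebraicClosure ℚ ℂ)) (P Q : MvPolynomial (Fin (n + 1)) ↥(algebraicClosure ℚ ℂ)), LinearIndependent ℚ β → IsRelPrime P Q → ∀ z : ℂ, z ≠ 0 → MvPolynomial.aeval (Fin.cons z fun i => Complex.exp ((β i : ℂ) * z)) P = 0 → MvPolynomial.aeval (Fin.cons z fun i => Complex.exp ((β i : ℂ) * z)) Q ≠ 0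

/-- item stmt-Schanuel-3764 · crux · rank 3 · open · by planner
why it might fail: Open since 1958 even for constant coefficients: two IRREDUCIBLE factors (Ritt Case 2) are handled only under SC (DaquinoMacintyreTerzo2014 §5, BMZ + Evertse–Schlickewei–Schmidt); one real slope of degree ≥ 3 or non-torsion phases has no p-adic/unit-orbit structure; Baker's k^{-C} is too weak.
sources: Shapiro1958, VanDerPoortenTijdeman1975, DaquinoMacintyreTerzo2014, MantovaZannier2016, EverestVanDerPoorten1997, Ritt1929
[crux] (card S3, re-graded crux by triage) Shapiro's conjecture over ℚ̄, finiteness rung of the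
purity ladder: two coprime exponential polynomials over ℚ̄ (same encoding, polynomial coefficients
allowed) have only FINITELY many common zeros. Trivially below crux 2 (FiniteOfNoCommonZero); under
Schanuel a theorem (FischlerRivoal2025 Thm 1.7; DaquinoMacintyreTerzo2014 for constant coefficients
over ℂ); unconditional when one factor is simple (VanDerPoortenTijdeman1975, p-adic
Skolem–Mahler–Lech) — the target where the route's engines already bite. [difficulty: open-problem] -/
@[route_item "route-Schanuel-CoprimeExpPolynomials", crux]
def CoprimeExpPolynomialsFiniteCommonZeros : Prop :=
  ∀ (n : ℕ) (β : Fin n → ↥(algebraicClosure ℚ ℂ)) (P Q : MvPolynomial (Fin (n + 1)) ↥(algebraicClosure ℚ ℂ)), LinearIndependent ℚ β → IsRelPrime P Q → Set.Finite {z : ℂ | MvPolynomial.aeval (Fin.cons z fun i => Complex.exp ((β i : ℂ) * z)) P = 0 ∧ MvPolynomial.aeval (Fin.cons z fun i => Complex.exp ((β i : ℂ) * z)) Q = 0}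

/-- item stmt-Schanuel-3765 · crux · rank 4 · open · by planner
why it might fail: Its cells are Gel'fond's conjecture (Waldschmidt2004 §3.1), (π, e^{iπ√2}) and the fixed points of exp, all at the d=2, ℓ=1 grid point below every algebraic-independence criterion (NesterenkoPhilippon2001 Ch.14 Thm 2.9 needs dℓ > d+ℓ); only the CM dilates y = πi, β = i√d are proved (Nesterenko 1996).
sources: Waldschmidt2004, Gelfond1934, NesterenkoPhilippon2001, Chudnovsky1984, FischlerRivoal2025, Marker2006
[crux] (card n = 2 form) the countable set 𝒮 = {y : (y, eʸ) algebraically dependent over ℚ} of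
simply-exponential-algebraic numbers (ℚ̄, log ℚ̄, πi·ℚ, fixed points of exp, Ω, zeros of every p(z,
eᶻ)) meets none of its irrational algebraic dilates off ℚ̄: y ∈ 𝒮 transcendental, β ∈ ℚ̄∖ℚ ⟹ (βy,
e^{βy}) algebraically independent. Equals the n = 2 layer of RankOneSchanuel given
Lindemann–Weierstrass (DilationOfRankOne); cells: y = log α (crux 5), y = πi (β = i√d PROVED:
Nesterenko; β = √2 open), y a fixed point of exp (no classical name). [difficulty: open-problem] -/
@[route_item "route-Schanuel-CoprimeExpPolynomials", crux]
def DilationRigidity : Prop :=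
  ∀ (y β : ℂ), Transcendental ℚ y → ¬ AlgebraicIndependent ℚ ![y, Complex.exp y] → IsAlgebraic ℚ β → β ∉ Set.range ((↑) : ℚ → ℂ) → AlgebraicIndependent ℚ ![β * y, Complex.exp (β * y)]

/-- item stmt-Schanuel-0084 · crux · rank 5 · open · by planner
why it might fail: Open even for (log 2, 2^√2) since Gelfond1934; the 2×2 grid (1, β)×(l) gives trdeg ≥ 1 only and every Gel'fond-type criterion needs dℓ > d+ℓ (NesterenkoPhilippon2001 Ch.14 Thm 2.9); the one proved case (α root of unity, β imaginary quadratic) is modular.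
sources: Gelfond1934, Chudnovsky1984, Waldschmidt2004, NesterenkoPhilippon2001
For algebraic α ∉ {0,1} (encoded: e^l = α, l ≠ 0) and algebraic irrational β, log α and α^β := e^{β
log α} are algebraically independent. Open even for (log 2, 2^√2). Grid point d=2 (x=(1,β)), l=1
(y=(log α)); = Schanuel n=2 at (l, βl). Sources: Waldschmidt2000 §1.4 open problems, Gelfond1934,
Lang1966. -/
@[route_item "route-Schanuel-CoprimeExpPolynomials", crux]
def LogAlphaAlphaBetaAlgIndep : Prop :=
  ∀ (α β l : ℂ), IsAlgebraic ℚ α → IsAlgebraic ℚ β → β ∉ Set.range ((↑) : ℚ → ℂ) → Complex.exp l = α → l ≠ 0 → AlgebraicIndependent ℚ ![l, Complex.exp (β * l)]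

/-- item stmt-Schanuel-3766 · support · rank 9 · open · by planner
sources: FischlerRivoal2025, Lang1966, Baker1975
[support] rank-one Schanuel in transcendence-degree form ("Lindemann–Weierstrass at a transcendental
scale"): ζ ≠ 0, β₁..βₙ algebraic and ℚ-linearly independent ⟹ trdeg_ℚ ℚ(ζ, e^{β₁ζ}, …, e^{βₙζ}) ≥ n.
The r = 1 layer of the target (RankOneOfGraded) and the hinge to crux 2 (CoprimeOfRankOne,
RankOneOfCoprime); a special case of Schanuel, OPEN (not provable now) — filed as the named
statement other routes/cards can share; ζ algebraic is Lindemann–Weierstrass (proved in tree).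
[difficulty: open-problem] -/
@[route_item "route-Schanuel-CoprimeExpPolynomials", crux]
def RankOneSchanuel : Prop :=
  ∀ (n : ℕ) (ζ : ℂ) (β : Fin n → ℂ), ζ ≠ 0 → (∀ i, IsAlgebraic ℚ (β i)) → LinearIndependent ℚ β → (n : Cardinal) ≤ Algebra.trdeg ℚ ↥(IntermediateField.adjoin ℚ (insert ζ (Set.range fun i => Complex.exp (β i * ζ))))

/-- item stmt-Schanuel-3767 · support · rank 9 · open · by planner
sources: FischlerRivoal2025, Lang1966
[support] trdeg form ⟹ zero-set form: if coprime P, Q ∈ ℚ̄[X₀..Xₙ] both vanish at q = (z, e^{βz})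
with z ≠ 0 then trdeg_ℚ ℚ(q) ≤ n − 1 (if it were n, the ideal of q would be a height-one prime,
principal in the UFD ℚ̄[X]; Gauss-lemma form: the primitive minimal polynomial of the one dependent
coordinate divides every relation, hence divides P and Q), contradicting RankOneSchanuel. Pure
commutative algebra over Mathlib (MvPolynomial.finSuccEquiv/renameEquiv, Polynomial.IsPrimitive
Gauss lemma). [difficulty: provable-now] -/
@[route_item "route-Schanuel-CoprimeExpPolynomials", crux]
def CoprimeOfRankOne : Prop :=
  RankOneSchanuel → CoprimeExpPolynomialsNoCommonZero

/-- item stmt-Schanuel-3768 · support · rank 9 · open · by planner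
sources: FischlerRivoal2025, Lang1966
[support] zero-set form ⟹ trdeg form (the direction not printed in FischlerRivoal2025): if trdeg_ℚ
ℚ(ζ, e^{βζ}) ≤ n − 1, take a maximal algebraically independent set S of coordinates (|S| ≤ n − 1)
and two further coordinates a, c; the primitive (hence irreducible, Gauss) minimal relation P of a
over ℚ̄[S] and any nonzero relation Q of c in ℚ̄[S][C] are relatively prime (P involves the variable
A, Q does not) and both vanish at the point — contradiction with crux 2 at z = ζ ≠ 0. [difficulty:
provable-now] -/
@[route_item "route-Schanuel-CoprimeExpPolynomials", crux]
def RankOneOfCoprime : Prop :=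
  CoprimeExpPolynomialsNoCommonZero → RankOneSchanuel

/-- item stmt-Schanuel-3769 · support · rank 9 · open · by planner
sources: Lang1966
[support] the r = 1 specialisation of the target: ζ : Fin 1 → ℂ has no algebraic relation iff ζ 0 ≠
0; b : Fin n → Fin 1 → ℂ ℚ-independent iff (b · 0) is; Fin.sum_univ_one and range ![ζ₀] = {ζ₀}
identify the two adjoins. [difficulty: provable-now] -/
@[route_item "route-Schanuel-CoprimeExpPolynomials", crux]
def RankOneOfGraded : Prop :=
  QbarRankGradedSchanuel → RankOneSchanuel

/-- item stmt-Schanuel-3770 · support · rank 9 · open · by planner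
sources: Lang1966, Waldschmidt2000
[support] calibration Schanuel ⟹ X: z := bζ is ℚ-linearly independent (ζ ℚ̄-free, rows of b ℚ-free),
Schanuel gives trdeg ℚ(z, eᶻ) ≥ n, and ℚ(z, eᶻ) ⊆ ℚ(b)(ζ, eᶻ) is algebraic over ℚ(ζ, eᶻ) (tree lemma
Literature.Barriers.Schanuel.trdeg_adjoin_union_eq_of_isAlgebraic pattern). With Assembly this
records X ⟺ Schanuel. [difficulty: provable-now] -/
@[route_item "route-Schanuel-CoprimeExpPolynomials", crux]
def GradedOfSchanuel : Prop :=
  Schanuel → QbarRankGradedSchanuel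

/-- item stmt-Schanuel-3771 · support · rank 9 · open · by planner
sources: FischlerRivoal2025, Waldschmidt2004
[support] the n = 2 layer: apply RankOneSchanuel to ζ = y, β = (1, β): trdeg ℚ(y, eʸ, e^{βy}) ≥ 2;
since eʸ is algebraic over ℚ(y) (y ∈ 𝒮), y and e^{βy} are algebraically independent, hence so are βy
and e^{βy} (β algebraic ≠ 0). [difficulty: provable-now] -/
@[route_item "route-Schanuel-CoprimeExpPolynomials", crux]
def DilationOfRankOne : Prop :=
  RankOneSchanuel → DilationRigidity

/-- item stmt-Schanuel-3772 · support · rank 9 · open · by planner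
sources: Lindemann1882, Waldschmidt2004
[support] crux 5 is the cell y = l of crux 4: eˡ = α ∈ ℚ̄ puts l in 𝒮, l is transcendental by
Hermite–Lindemann (tree: Literature.NumberTheory.Transcendental.LindemannWeierstrass, proved), and
algebraic independence of (βl, e^{βl}) transfers to (l, e^{βl}). [difficulty: provable-now] -/
@[route_item "route-Schanuel-CoprimeExpPolynomials", crux]
def LogCellOfDilation : Prop :=
  DilationRigidity → LogAlphaAlphaBetaAlgIndep

/-- item stmt-Schanuel-3773 · support · rank 9 · open · by planner
sources: FischlerRivoal2025, Shapiro1958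
[support] the finiteness rung sits below crux 2: the common-zero set is a subset of {0} (encoding
check; 6-line proof in the planner's Sketch.lean). [difficulty: provable-now] -/
@[route_item "route-Schanuel-CoprimeExpPolynomials", crux]
def FiniteOfNoCommonZero : Prop :=
  CoprimeExpPolynomialsNoCommonZero → CoprimeExpPolynomialsFiniteCommonZeros

/-- item stmt-Schanuel-3774 · assembly · rank 1 · open · by planner
sources: Lang1966, FischlerRivoal2025
[assembly] QbarRankGradedSchanuel → Schanuel (ℚ̄-basis extraction + trdeg invariance under algebraic
elements). -/
@[route_item "route-Schanuel-CoprimeExpPolynomials", crux]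
def Assembly : Prop :=
  QbarRankGradedSchanuel → Schanuel

/-! D-0027 §2.1 — DECIDING THEOREM (planner-authored via `route open/edit --closes-file`; by planner-rbadge-Schanuel-CoprimeExpPolynomials-9c015002-g2-0 2026-08-15T16:16:02Z):
its hypotheses are this route's items and its conclusion the sub-problem Statement (glue_lint), and it elaborates with this file. -/

/-- D-0027 §2.1 deciding theorem of route CoprimeExpPolynomials: hypotheses = the route's 14 items (the target
`QbarRankGradedSchanuel`, 4 cruxes, 8 supports, the bookkeeping `Assembly`), conclusion = the sub-problem Statement
`Schanuel` by name. Content: `Assembly` (ℚ̄-basis extraction + invariance of `trdeg` under adjoining algebraic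
elements: `QbarRankGradedSchanuel → Schanuel`) applied to the target `QbarRankGradedSchanuel` (Schanuel graded by exact
ℚ̄-rank; `GradedOfSchanuel` records the converse, so X ⟺ Schanuel). The ranked cruxes are the r = 1 / n = 2 layers of
the target and are wired to it by the supports `RankOneOfGraded`, `CoprimeOfRankOne`, `RankOneOfCoprime`,
`FiniteOfNoCommonZero`, `DilationOfRankOne`, `LogCellOfDilation`; they are listed so that every item of the route is a
hypothesis of the deciding theorem, but only the target and the assembly are used. Axioms: none beyond the items. -/
@[closes "route-Schanuel-CoprimeExpPolynomials"] theorem closes (hAssembly : Assembly) (hGraded : QbarRankGradedSchanuel)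
    (_hCoprime : CoprimeExpPolynomialsNoCommonZero) (_hFinite : CoprimeExpPolynomialsFiniteCommonZeros)
    (_hDilation : DilationRigidity) (_hLog : LogAlphaAlphaBetaAlgIndep) (_hRankOne : RankOneSchanuel)
    (_hCoprimeOfRankOne : CoprimeOfRankOne) (_hRankOneOfCoprime : RankOneOfCoprime)
    (_hRankOneOfGraded : RankOneOfGraded) (_hGradedOfSchanuel : GradedOfSchanuel)
    (_hDilationOfRankOne : DilationOfRankOne) (_hLogCell : LogCellOfDilation)
    (_hFiniteOfNoCommonZero : FiniteOfNoCommonZero) : _root_.Schanuel :=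
  hAssembly hGraded

end Summit.Schanuel.Schanuel.Theses.CoprimeExpPolynomials
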